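import Summits.HodgeConjecture.CorCM.HCCMOfRankFourWeilClasses
import Literature.AlgebraicGeometry.HodgeTheory.IsoTransport
import HarnessLib

/-!
# COR-CM (cell `pub-hodgecm2`): the crux `FaceReduction` follows from rank-four transport and families through the CM
# CORNER PRODUCTS OF FACES only — the minimal form of stub A of the line `birth`

HONEST FRAMING (cell pub-hodgecm2 / COR-CM, seat b24 gen 21, count-neutral lane RANK4-HCCM, part 4; theorems only, no
definition, no named fact; no case of the Hodge conjecture is proved).  The crux `FaceReduction`
(stmt-HodgeConjecture-16266, `RankFourWeilTransport → CMAbelianHodge`) of the route `RankFourFaces` is, by part 1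
(`RankFourWeil.faceReduction_iff_transport_imp_faceWeilClasses`), EXACTLY the statement that rank-four transport makes the
rational `(2,2)` classes of `W_F ⊗ ℂ` on the CM corner products `⨁_j A_{(F, f.corner j)}` of the rank-four faces `f` of
the Galois CM fields `F` of degree `≥ 6` algebraic.  The line `birth` (`Cruxes/FaceReduction/Lines/birth.lean`) feeds the
transport with its stub A `CMProductsReachRankFourFamily`: EVERY E-CM 4-product of Weil type, for EVERY CM polynomial `P`,
reaches an algebraic anchor inside a smooth projective rank-four E-family.  This file records the MINIMAL family statement
the crux needs, with the glue proved:

* **`hc_cm_of_transport_of_cornerFamilies`** — if for every Galois CM field `F` with `6 ≤ [F:ℚ]`, every face `f`,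
  every separating integer `a₀ ∈ 𝓞_F` and every RATIONAL `(2,2)` class `w` of
  `weilClassesField (⨁_j A_{(F, f.corner j)}) (act a₀) (minpoly_ℤ a₀) 4` there are a smooth projective family
  `fam : 𝒳 ⟶ S` of relative dimension `4g` (`g = [F:ℚ]/2`) over an irreducible smooth base, all of whose fibres are
  `≅ (A', φ')` with `dim A' = 4g`, `minpoly_ℤ a₀ (φ') = 0`, a point `s₁` with `e : 𝒳_{s₁} ≅ ⨁_j A_{(F, f.corner j)}`, a global
  class `W ∈ H⁴(𝒳(ℂ);ℂ)` rational of type `(2,2)` on every fibre with `W|_{s₁} = e^* w`, and a fibre `s₀` where `W` is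
  algebraic — **then `RankFourWeilTransport → HC_CM`, i.e. `FaceReduction`**.  (The transport is applied at
  `P = minpoly_ℤ a₀`, a CM polynomial of degree `2g ≥ 6` — `AndreProductForm.minpoly_facts`,
  `Milne2020.isGaloisCMFieldPoly_minpoly` —; algebraicity crosses `e` by `HodgeTheory.mem_algebraicClasses_map_iff_of_iso`;
  then part 1's face form `hc_cm_of_forall_face_weilClassesField`.)  Compared with stub A: only `|faces(F)|` products per
  field, only `P = minpoly_ℤ a₀` of ONE separating integer, only fields of degree `≥ 6`, and no product-cone / Weil-type
  bookkeeping (the corner products carry those by part 2); `faceReduction_of_cornerFamilies` — the same with the four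
  data of the model universe discharged, concluding the crux `FaceReduction` BY NAME.

References: [CharlesSchnell2014Notes] Prop. 11.5.22, Prop. 11.5.23, Thm. 11.5.24 (Deligne's split rank-four family and its
`ℚ`-split anchor); [Deligne1982HodgeCycles] §4–§5; [MoonenZarhin1998WeilClasses] §1; [Pohlmann1968] Thm. 1;
[Andre1992HodgeCM] Théorème; rfwf v3 Thm 1.3 / [QW8] Thm 2.5.
-/

noncomputable section

open CategoryTheory CategoryTheory.Limits NumberField Polynomial
open Literature.AlgebraicGeometry Literature.AlgebraicGeometry.Motives Literature.AlgebraicGeometry.HodgeTheory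
open Literature.AlgebraicGeometry.ComplexMultiplication Literature.AlgebraicGeometry.Milne1999
open Literature.NumberTheory.Automorphic
open Literature.NumberTheory.Automorphic.PicardCM (BallQuotientUniformisedDatum CMAbelianVarietyRealised)
open Summit.HodgeConjecture.CorCM.Model
open Summit.HodgeConjecture.CorCM.AndreProductForm
open Summit.HodgeConjecture.CorCM.Milne2020
open Summit.HodgeConjecture.HodgeConjecture.Theses.RankFourFaces (CMAbelianHodge RankFourWeilTransport FaceReduction)

namespace Summit.HodgeConjecture.CorCM.RankFourWeil

/-- **`FaceReduction` from rank-four transport and families through the CM corner products of faces ONLY** (the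
minimal form of stub A of the line `birth`; any instance `h₃` of the realisation record).  Hypothesis `hA`: every rational
`(2,2)` class `w` of `W_F ⊗ ℂ = weilClassesField (⨁_j A_{(F, f.corner j)}) (act a₀) (minpoly_ℤ a₀) 4` (Galois CM `F`,
`6 ≤ [F:ℚ]`, face `f`, separating `a₀`) sits in a smooth projective family of abelian `4g`-folds with
`minpoly_ℤ a₀`-multiplication (`g = [F:ℚ]/2`) over an irreducible smooth base, as the restriction `W|_{s₁} = e^* w` of a
global class `W` that is rational `(2,2)` on every fibre and ALGEBRAIC on some fibre `s₀`.  Conclusion: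
`RankFourWeilTransport → HC_CM`.  Proof: transport (at the CM polynomial `P = minpoly_ℤ a₀` of degree `2g ≥ 6`) carries
algebraicity from `s₀` to `s₁`, the isomorphism `e` carries it to `w` (`mem_algebraicClasses_map_iff_of_iso`), and the face
form of `HC_CM` (`hc_cm_of_forall_face_weilClassesField`) concludes.
[cite: CharlesSchnell2014Notes, Prop. 11.5.23 and Thm. 11.5.24] [cite: MoonenZarhin1998WeilClasses, §1]
[cite: Pohlmann1968, Thm. 1] -/
theorem hc_cm_of_transport_of_cornerFamilies (hHD : exists_isReal_hodgeModel) (hI : hodgePQ_independent_of_hodgeModel)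
    (hU : BallQuotientUniformisedDatum) (h₃ : CMAbelianVarietyRealised) (hT : RankFourWeilTransport)
    (hA : ∀ (F : CMField), IsGalois ℚ F → 6 ≤ Module.finrank ℚ F → ∀ (f : Face F) (a₀ : 𝓞 F),
      (Function.Injective fun σ : (F : Type) →+* ℂ => σ (a₀ : F)) →
      ∀ w ∈ weilClassesField (⨁ cornerAV h₃ F f.corner)
          (diagHom F (cornerAV h₃ F f.corner) (cornerAct h₃ F f.corner) a₀) (minpoly ℤ a₀) (2 * 2),
        IsRationalClass w →
        IsOfHodgeType (⨁ cornerAV h₃ F f.corner).dim (⨁ cornerAV h₃ F f.corner).X (2 * 2) 2 2 w →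
        ∃ (𝒳 S : SchemeOver ℂ) (fam : 𝒳 ⟶ S),
          IsSmoothProjectiveFamily fam (4 * (Module.finrank ℚ F / 2)) ∧ IrreducibleSpace S.left ∧
          AlgebraicGeometry.Smooth S.hom ∧
          (∀ s : ComplexPoints S, ∃ (A' : AbelianVariety ℂ) (φ' : A' ⟶ A'),
            A'.dim = 4 * (Module.finrank ℚ F / 2) ∧
            Polynomial.eval₂ (Int.castRingHom (CategoryTheory.End A')) (φ' : CategoryTheory.End A') (minpoly ℤ a₀) = 0 ∧
            Nonempty (A'.X ≅ fiberOver fam s)) ∧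
          ∃ (s₁ : ComplexPoints S) (e : fiberOver fam s₁ ≅ (⨁ cornerAV h₃ F f.corner).X) (W : complexBetti 𝒳 4),
            (∀ s : ComplexPoints S, IsRationalClass (complexBetti.map (fiberι fam s) 4 W) ∧
              IsOfHodgeType (4 * (Module.finrank ℚ F / 2)) (fiberOver fam s) 4 2 2
                (complexBetti.map (fiberι fam s) 4 W)) ∧
            complexBetti.map (fiberι fam s₁) 4 W = complexBetti.map e.hom 4 w ∧
            ∃ s₀ : ComplexPoints S, complexBetti.map (fiberι fam s₀) 4 W ∈ algebraicClasses (fiberOver fam s₀) 2) :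
    HC_CM := by
  refine hc_cm_of_forall_face_weilClassesField hHD hI hU h₃ ?_
  intro F hG h6 f a₀ hsep w hw hwQ hwH
  haveI : IsGalois ℚ (F : Type) := hG
  obtain ⟨hPm, hPirr, hPe, -, -⟩ := minpoly_facts (F : Type) a₀ hsep
  obtain ⟨-, -, -, -, hreal, hQ, -⟩ := isGaloisCMFieldPoly_minpoly (F : Type) a₀ hsep
  -- `[F:ℚ] = 2g` with `g ≥ 3`
  have hfin : Module.finrank ℚ F = 2 * (Module.finrank ℚ F / 2) := by
    have h1 := IsTotallyComplex.finrank (K := (F : Type))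
    omega
  have hg : 2 ≤ Module.finrank ℚ F / 2 := by omega
  -- the family through `(⨁_j A_{(F, f.corner j)}, w)` with its algebraic anchor
  obtain ⟨𝒳, S, fam, hfam, hirr, hsm, hfib, s₁, e, W, hW, hWs₁, s₀, hs₀⟩ := hA F hG h6 f a₀ hsep w hw hwQ hwH
  -- transport at the CM polynomial `minpoly_ℤ a₀`
  have h := hT (Module.finrank ℚ F / 2) hg (minpoly ℤ a₀) hPm (hPe.trans hfin) hPirr
    (fun ρ hρ him => hreal ρ hρ (Complex.conj_eq_iff_im.mpr him))
    (by obtain ⟨Q, hQ⟩ := hQ; exact ⟨Q, fun ρ hρ => by rw [Polynomial.aeval_def]; exact hQ ρ hρ⟩)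
    fam hfam hirr hsm hfib W hW ⟨s₀, hs₀⟩ s₁
  rw [hWs₁] at h
  exact (mem_algebraicClasses_map_iff_of_iso (p := 2) e).1 h

/-- **The minimal stub A closes the crux**: with all four data of the model universe discharged by the tree theorems
(`exists_isReal_hodgeModel_holds`, `hodgePQ_independent_of_hodgeModel_holds`, `BallQuotient.ballQuotientUniformisedDatum_holds`,
`cmAbelianVarietyRealised_holds`), families through the CM corner products of the rank-four faces of the Galois CM fields of
degree `≥ 6` (hypothesis `hA` of `hc_cm_of_transport_of_cornerFamilies`, at `h₃ = cmAbelianVarietyRealised_holds`) give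
`FaceReduction : RankFourWeilTransport → CMAbelianHodge` (stmt-HodgeConjecture-16266) — the route's crux BY NAME.
[cite: CharlesSchnell2014Notes, Prop. 11.5.23 and Thm. 11.5.24] [cite: Pohlmann1968, Thm. 1] -/
theorem faceReduction_of_cornerFamilies
    (hA : ∀ (F : CMField), IsGalois ℚ F → 6 ≤ Module.finrank ℚ F → ∀ (f : Face F) (a₀ : 𝓞 F),
      (Function.Injective fun σ : (F : Type) →+* ℂ => σ (a₀ : F)) →
      ∀ w ∈ weilClassesField (⨁ cornerAV cmAbelianVarietyRealised_holds F f.corner)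
          (diagHom F (cornerAV cmAbelianVarietyRealised_holds F f.corner)
            (cornerAct cmAbelianVarietyRealised_holds F f.corner) a₀) (minpoly ℤ a₀) (2 * 2),
        IsRationalClass w →
        IsOfHodgeType (⨁ cornerAV cmAbelianVarietyRealised_holds F f.corner).dim
          (⨁ cornerAV cmAbelianVarietyRealised_holds F f.corner).X (2 * 2) 2 2 w →
        ∃ (𝒳 S : SchemeOver ℂ) (fam : 𝒳 ⟶ S),
          IsSmoothProjectiveFamily fam (4 * (Module.finrank ℚ F / 2)) ∧ IrreducibleSpace S.left ∧
          AlgebraicGeometry.Smooth S.hom ∧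
          (∀ s : ComplexPoints S, ∃ (A' : AbelianVariety ℂ) (φ' : A' ⟶ A'),
            A'.dim = 4 * (Module.finrank ℚ F / 2) ∧
            Polynomial.eval₂ (Int.castRingHom (CategoryTheory.End A')) (φ' : CategoryTheory.End A') (minpoly ℤ a₀) = 0 ∧
            Nonempty (A'.X ≅ fiberOver fam s)) ∧
          ∃ (s₁ : ComplexPoints S) (e : fiberOver fam s₁ ≅ (⨁ cornerAV cmAbelianVarietyRealised_holds F f.corner).X)
            (W : complexBetti 𝒳 4),
            (∀ s : ComplexPoints S, IsRationalClass (complexBetti.map (fiberι fam s) 4 W) ∧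
              IsOfHodgeType (4 * (Module.finrank ℚ F / 2)) (fiberOver fam s) 4 2 2
                (complexBetti.map (fiberι fam s) 4 W)) ∧
            complexBetti.map (fiberι fam s₁) 4 W = complexBetti.map e.hom 4 w ∧
            ∃ s₀ : ComplexPoints S, complexBetti.map (fiberι fam s₀) 4 W ∈ algebraicClasses (fiberOver fam s₀) 2) :
    FaceReduction := by
  unfold FaceReduction
  exact fun hT => hc_cm_of_transport_of_cornerFamilies exists_isReal_hodgeModel_holds
    hodgePQ_independent_of_hodgeModel_holds BallQuotient.ballQuotientUniformisedDatum_holds cmAbelianVarietyRealised_holds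
    hT hA

end Summit.HodgeConjecture.CorCM.RankFourWeil

end
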